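import Mathlib
import HarnessLib
import Literature.Analysis.FluidPDE.AncientSimilarityVariables
import Literature.Analysis.FluidPDE.ClassicalSolutionRegion
import Literature.Analysis.FluidPDE.ClassicalSolutionGlue
import Literature.Analysis.FluidPDE.ParasiticSlabFlow
import Literature.Analysis.FluidPDE.PineauVicolLerayPressure
import Literature.Analysis.FluidPDE.PineauVicolPressureIdentification
import Literature.Analysis.FluidPDE.PineauVicolPressureDerivativesDecay
import Literature.Analysis.FluidPDE.PineauVicolProfileTimeDerivativeDecay
import Summits.NavierStokesRegularity.NavierStokesRegularity.Theorems.QuarterLogPincerFlatWindowDefs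
import Summits.NavierStokesRegularity.NavierStokesRegularity.Theorems.QuantisedSymmetryPolyhedralDssProfileExistsStubAncientMildOfClassicalTypeI

/-!
# Crux `QuarterLogPincer.TypeIQuantSubcubicExp` (stmt-NavierStokesRegularity-24077), rung line `flat_window`:
  STUB (M) `stub_annulusPressure` — PROVED (Pineau–Vicol 2026 (1.16) / Lemma 2.1 in the Type-I class)

Lead-prover file (ns-tc-p1 g4; DIRECTOR-NS #210 (1); `--supports stmt-NavierStokesRegularity-24077
--as helper`) proving BY NAME, with its verbatim signature
`stub_annulusPressure : ∀ C₀, 0 < C₀ → ∃ Cp, 0 < Cp ∧ AnnulusPressure C₀ Cp`, the pressure obligation of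
ns-idea-7's rung line `Cruxes/TypeIQuantSubcubicExp/Lines/flat_window.lean` (183c0c8f2f447a08,
idea-crit-7 PASS-WITH-PRICE) over `Theorems/QuarterLogPincerFlatWindowDefs.lean` (`pvRegion`,
`AnnulusPressure` verbatim).

The pressure chosen is the given one normalised at a fixed annulus point,
`p'(t,x) = p(t,x) − p(t,e)`, `e = (5/8)e₁`: it is jointly smooth, has the same gradient (so `(u,p')`
is classical on the open past and restricts to the region `pvRegion = [−1,0) × B₁`), and equals
`Q[u(t)](x) − Q[u(t)](e)` for the Calderón–Zygmund pressure `Q[u(t)] = RᵢRⱼ(uᵢuⱼ)(t)` because the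
pressure of a Type-I classical solution is the Riesz pressure up to a function of time
(`pressure_sub_pressurePotential_const`, Tao's normalisation on the decay class, tree
`PineauVicol2026.pressure_sub_pressurePotential_eq_decay`).  The bound `|Q[u(t)](x)| ≤ D(C₀)/‖x‖²`
(`abs_pressurePotential_le_div_sq`) is the order-zero profile-pressure decay
`|Q[U(s)](y)| ≤ A K²/(1+|y|)²` of the class (`exists_bound_abs_pressurePotentialSym_decay` with the
class-uniform (8.3) bounds `exists_forall_le_pow_mul_norm_iteratedFDeriv_lerayOrbit_of_hasTypeIDecay`)
read in physical variables through the dilation covariance `Q[λv(λ·)](y) = λ²Q[v](λy)`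
(`pressurePotential_smul_comp_smul`): `|Q[u(t)](x)| ≤ A K²/(√(−t)+‖x‖)² ≤ A K²/‖x‖²`, uniformly in
`t < 0` (no `(−t)^{−σ}` loss, as the critic notes).

HONEST FRAMING: an obligation of a RUNG line on the DSS wall (near-one window); the line does not
conclude the crux; `TypeIQuantSubcubicExp`, `SuperlogCubeRate` and Navier–Stokes regularity remain OPEN;
no summit statement is proved by this file.
-/

noncomputable section

-- the summit-side namespace `Summit.NavierStokesRegularity.NavierStokesRegularity.…` (single-conjunct summit,
-- D-0017) repeats a component by design; the dupNamespace linter would flag every declaration.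
set_option linter.dupNamespace false

namespace Summit.NavierStokesRegularity.NavierStokesRegularity.Cruxes.TypeIQuantSubcubicExp.FlatWindow

open MeasureTheory Set Function Filter Topology Metric
open scoped ContDiff
open Literature.Analysis Literature.Analysis.FluidPDE
open Summit.NavierStokesRegularity.NavierStokesRegularity.Theorems

/-! ### The pressure of a Type-I classical ancient solution is the Riesz pressure mod `h(t)` -/

/-- **Tao's normalisation on the whole open past**: for a classical solution `(u,p)` on
`(−∞,0) × ℝ³` (`ν = 1`, zero force) with the Type-I bound `‖u(t,x)‖ ≤ C₀/(‖x‖ + √(−t))`,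
`p(t,x) − Q[u(t)](x)` does not depend on `x`, for every `t < 0` (time translation of the window
`[t−1, t/2]` to `[0,T]`, decay constant `C₀/min(1,√(−t/2))`, and the tree's
`PineauVicol2026.pressure_sub_pressurePotential_eq_decay`; the tree's `gradient_pressure_eq_of_typeI`
is the same on `[−1,0)`). [folklore] -/
theorem pressure_sub_pressurePotential_const {C₀ : ℝ}
    {u : ℝ → EuclideanSpace ℝ (Fin 3) → EuclideanSpace ℝ (Fin 3)}
    {p : ℝ → EuclideanSpace ℝ (Fin 3) → ℝ} (hcl : IsClassicalNSSolutionOn (Iio 0) 1 0 u p)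
    (hI : HasTypeIDecay C₀ u) {t : ℝ} (ht : t < 0) (x : EuclideanSpace ℝ (Fin 3)) :
    p t x - pressurePotential (u t) x = p t 0 - pressurePotential (u t) 0 := by
  have hC₀ : 0 ≤ C₀ := nonneg_of_hasTypeIDecay hI
  -- the window `[t₁, t₂] = [t − 1, t/2]`
  set t₁ : ℝ := t - 1 with ht₁
  set t₂ : ℝ := t / 2 with ht₂
  have h2 : t₁ < t := by rw [ht₁]; linarith
  have h3 : t < t₂ := by rw [ht₂]; linarith
  have h4 : t₂ < 0 := by rw [ht₂]; linarith
  set T : ℝ := t₂ - t₁ with hT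
  have hT0 : 0 < T := by rw [hT]; linarith
  -- the translated solution on `[0, T]`
  have hsol' : IsClassicalNSSolutionOn (Icc 0 T) 1 0 (fun s => u (s + t₁)) (fun s => p (s + t₁)) := by
    have h := hcl.comp_add_right t₁
    refine h.mono (fun s hs => ?_) (uniqueDiffOn_Icc hT0)
    simp only [mem_preimage, mem_Iio]
    linarith [hs.2]
  -- the decay constant on the window
  set δ : ℝ := Real.sqrt (-t₂) with hδ
  have hδ0 : 0 < δ := Real.sqrt_pos.2 (by linarith)
  set m : ℝ := min 1 δ with hm
  have hm0 : 0 < m := lt_min one_pos hδ0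
  have hdec : ∀ s ∈ Icc 0 T, ∀ y, ‖u (s + t₁) y‖ ≤ C₀ / m / (1 + ‖y‖) := by
    intro s hs y
    have hτ : s + t₁ < 0 := by linarith [hs.2]
    have hτ2 : -(s + t₁) ≥ -t₂ := by linarith [hs.2]
    have hsq : δ ≤ Real.sqrt (-(s + t₁)) := Real.sqrt_le_sqrt hτ2
    have hden : m * (1 + ‖y‖) ≤ ‖y‖ + Real.sqrt (-(s + t₁)) := by
      have hm1 : m ≤ 1 := min_le_left _ _
      have hmδ : m ≤ δ := min_le_right _ _
      nlinarith [norm_nonneg y]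
    have hpos : 0 < m * (1 + ‖y‖) := by positivity
    calc ‖u (s + t₁) y‖ ≤ C₀ / (‖y‖ + Real.sqrt (-(s + t₁))) := hI _ hτ y
      _ ≤ C₀ / (m * (1 + ‖y‖)) := div_le_div_of_nonneg_left hC₀ hpos hden
      _ = C₀ / m / (1 + ‖y‖) := by rw [div_div]
  have key := PineauVicol2026.pressure_sub_pressurePotential_eq_decay zero_le_one hsol' (by positivity)
    hdec (t := t - t₁) ⟨by linarith, by rw [hT]; linarith⟩ x
  simpa only [sub_add_cancel] using key

/-! ### The Calderón–Zygmund pressure of the class away from the origin -/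

/-- **`|Q[u(t)](x)| ≤ D(C₀)/‖x‖²` for `x ≠ 0`, uniformly in `t < 0`, on the Type-I class.**  The
order-zero profile-pressure decay `|Q[U(s)](y)| ≤ A K²/(1+‖y‖)²` (`U = lerayOrbit u`; the tree's
`exists_bound_abs_pressurePotentialSym_decay` fed with the class-uniform (8.3) bounds to order `2`)
transported by the dilation covariance `Q[λ v(λ·)](y) = λ² Q[v](λy)`, `λ = √(−t)`:
`|Q[u(t)](x)| ≤ A K²/(√(−t) + ‖x‖)² ≤ A K²/‖x‖²`. [folklore] -/
theorem abs_pressurePotential_le_div_sq (C₀ : ℝ) :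
    ∃ D : ℝ, 0 ≤ D ∧ ∀ (u : ℝ → EuclideanSpace ℝ (Fin 3) → EuclideanSpace ℝ (Fin 3))
      (p : ℝ → EuclideanSpace ℝ (Fin 3) → ℝ),
      IsClassicalNSSolutionOn (Iio 0) 1 0 u p → HasTypeIDecay C₀ u →
      ∀ t : ℝ, t < 0 → ∀ x : EuclideanSpace ℝ (Fin 3), x ≠ 0 →
        |pressurePotential (u t) x| ≤ D / ‖x‖ ^ 2 := by
  obtain ⟨K, hK0, hK⟩ :=
    IsTypeIAncientMild.exists_forall_le_pow_mul_norm_iteratedFDeriv_lerayOrbit_of_hasTypeIDecay 2 C₀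
  obtain ⟨A, hA0, hA⟩ := PineauVicol2026.exists_bound_abs_pressurePotentialSym_decay
  refine ⟨A * K * K, by positivity, fun u p hcl hI t ht x hx => ?_⟩
  have hC₀ : 0 ≤ C₀ := nonneg_of_hasTypeIDecay hI
  have hAm : IsTypeIAncientMild C₀ u :=
    PolyhedralDssProfileExists.Birth.isTypeIAncientMild_of_classical_typeI hcl hI
  have hpos : 0 < -t := neg_pos.2 ht
  set lam : ℝ := Real.sqrt (-t) with hlam
  have hlam0 : 0 < lam := Real.sqrt_pos.2 hpos
  have hxn : 0 < ‖x‖ := norm_pos_iff.2 hx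
  -- the profile slice at `s = −log(−t)` is the dilate `λ u(t)(λ ·)`
  set s : ℝ := -Real.log (-t) with hs
  have he1 : Real.exp (-s) = -t := by rw [hs, neg_neg, Real.exp_log hpos]
  have he2 : Real.exp (-s / 2) = lam := by
    rw [hs, neg_neg, hlam, eq_comm, Real.sqrt_eq_iff_eq_sq hpos.le (Real.exp_pos _).le, sq,
      ← Real.exp_add, add_halves, Real.exp_log hpos]
  have hUs : lerayOrbit u s = fun z => lam • u t (lam • z) := by
    rw [lerayOrbit_slice, he1, he2, neg_neg]
  -- (8.3) to order 2 for the slice, and the order-zero pressure decay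
  have hsm : ContDiff ℝ ∞ (lerayOrbit u s) :=
    (isClassicalNSSolutionOn_Iio_iff_isBackwardLeraySolutionOn.1 hcl).contDiff_velocity (mem_univ s)
  have h83 : ∀ j ≤ 2, ∀ y, (1 + ‖y‖) ^ (j + 1) * ‖iteratedFDeriv ℝ j (lerayOrbit u s) y‖ ≤ K :=
    fun j hj y => hK hAm hI s j hj y
  have hQU : ∀ y, |pressurePotential (lerayOrbit u s) y| ≤ A * K * K / (1 + ‖y‖) ^ 2 := by
    intro y
    have h := hA (lerayOrbit u s) (lerayOrbit u s) K K hsm hsm h83 h83 y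
    rwa [pressurePotentialSym_self] at h
  -- dilation covariance
  have hu2 : ContDiff ℝ 2 (u t) := (hcl.contDiff_velocity ht).of_le (by norm_cast)
  set m : ℝ := min 1 lam with hm
  have hm0 : 0 < m := lt_min one_pos hlam0
  have hdec : ∀ y, ‖u t y‖ ≤ C₀ / m / (1 + ‖y‖) := by
    intro y
    have hden : m * (1 + ‖y‖) ≤ ‖y‖ + lam := by
      have hm1 : m ≤ 1 := min_le_left _ _
      have hm2 : m ≤ lam := min_le_right _ _
      nlinarith [norm_nonneg y]
    have hp : 0 < m * (1 + ‖y‖) := by positivity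
    calc ‖u t y‖ ≤ C₀ / (‖y‖ + Real.sqrt (-t)) := hI t ht y
      _ ≤ C₀ / (m * (1 + ‖y‖)) := div_le_div_of_nonneg_left hC₀ hp hden
      _ = C₀ / m / (1 + ‖y‖) := by rw [div_div]
  have hscale := PineauVicol2026.pressurePotential_smul_comp_smul hu2 hdec hlam0 (lam⁻¹ • x)
  rw [smul_smul, mul_inv_cancel₀ hlam0.ne', one_smul, ← hUs] at hscale
  -- `Q[u t](x) = λ⁻² Q[U(s)](λ⁻¹ x)`
  have hQx : pressurePotential (u t) x = (lam ^ 2)⁻¹ * pressurePotential (lerayOrbit u s) (lam⁻¹ • x) := by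
    rw [hscale, ← mul_assoc, inv_mul_cancel₀ (by positivity), one_mul]
  rw [hQx, abs_mul, abs_inv, abs_of_pos (by positivity : (0 : ℝ) < lam ^ 2)]
  have h1 := hQU (lam⁻¹ • x)
  have hny : ‖lam⁻¹ • x‖ = lam⁻¹ * ‖x‖ := by
    rw [norm_smul, norm_inv, Real.norm_of_nonneg hlam0.le]
  rw [hny] at h1
  -- `λ⁻² · A K²/(1 + ‖x‖/λ)² = A K²/(λ + ‖x‖)² ≤ A K²/‖x‖²`
  have hden : (lam ^ 2)⁻¹ * (A * K * K / (1 + lam⁻¹ * ‖x‖) ^ 2) = A * K * K / (lam + ‖x‖) ^ 2 := by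
    field_simp
  calc (lam ^ 2)⁻¹ * |pressurePotential (lerayOrbit u s) (lam⁻¹ • x)|
      ≤ (lam ^ 2)⁻¹ * (A * K * K / (1 + lam⁻¹ * ‖x‖) ^ 2) :=
        mul_le_mul_of_nonneg_left h1 (by positivity)
    _ = A * K * K / (lam + ‖x‖) ^ 2 := hden
    _ ≤ A * K * K / ‖x‖ ^ 2 := by
        apply div_le_div_of_nonneg_left (by positivity) (by positivity)
        nlinarith [norm_nonneg x]

/-! ### The stub -/

/-- The annulus reference point `e = (5/8) e₁`, of norm `5/8 ∈ (1/2, 3/4)`. [folklore] -/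
theorem norm_single_five_eighths :
    ‖(EuclideanSpace.single (0 : Fin 3) (5 / 8 : ℝ) : EuclideanSpace ℝ (Fin 3))‖ = 5 / 8 := by
  rw [EuclideanSpace.single, PiLp.norm_single, Real.norm_of_nonneg (by norm_num)]

/-- **STUB (M) `stub_annulusPressure` of LINE `flat_window` — PROVED (signature verbatim).**  For every
`C₀ > 0` there is `Cp = Cp(C₀) > 0` such that every classical ancient solution `(u,p)` on
`(−∞,0) × ℝ³` in the Type-I envelope class `HasTypeIDecay C₀ u` admits a pressure `p'` — the given
one normalised at the annulus point `e = (5/8)e₁`, `p' = p − p(·,e)`, which equals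
`Q[u(t)] − Q[u(t)](e)` (`pressure_sub_pressurePotential_const`) — making `(u,p')` classical on
`pvRegion = [−1,0) × B₁` (same gradient; restriction of the slab solution, one-sided time derivative
at `t = −1`) with `|p'(t,x)| ≤ Cp` on `{1/2 < ‖x‖ < 3/4} × [−1,0)`
(`abs_pressurePotential_le_div_sq` at `x` and at `e`). [folklore] -/
theorem stub_annulusPressure : ∀ C₀ : ℝ, 0 < C₀ → ∃ Cp : ℝ, 0 < Cp ∧ AnnulusPressure C₀ Cp := by
  intro C₀ _hC₀
  obtain ⟨D, hD0, hD⟩ := abs_pressurePotential_le_div_sq C₀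
  refine ⟨8 * D + 1, by positivity, ?_⟩
  intro u p hcl hI
  set e : EuclideanSpace ℝ (Fin 3) := EuclideanSpace.single (0 : Fin 3) (5 / 8 : ℝ) with he_def
  have he : ‖e‖ = 5 / 8 := norm_single_five_eighths
  have he0 : e ≠ 0 := by
    intro h; rw [h, norm_zero] at he; norm_num at he
  -- the normalised pressure
  refine ⟨fun t x => p t x - p t e, ?_, ?_⟩
  · -- `(u, p')` is classical on the open past, hence on the region
    have hsm : IsSmoothSpaceTimeOn (Iio 0) (fun t x => p t x - p t e) := by
      have hp := hcl.smooth_pressure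
      unfold IsSmoothSpaceTimeOn at hp ⊢
      have hc : ContDiff ℝ ∞ (fun z : ℝ × EuclideanSpace ℝ (Fin 3) => ((z.1, e) : ℝ × EuclideanSpace ℝ (Fin 3))) :=
        contDiff_fst.prodMk contDiff_const
      have h2 : ContDiffOn ℝ ∞ (fun z : ℝ × EuclideanSpace ℝ (Fin 3) => uncurry p (z.1, e))
          (Iio 0 ×ˢ univ) :=
        hp.comp hc.contDiffOn (fun z hz => mk_mem_prod (mem_prod.1 hz).1 (mem_univ _))
      exact hp.sub h2
    have hcl' : IsClassicalNSSolutionOn (Iio 0) 1 0 u (fun t x => p t x - p t e) := by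
      refine ⟨hcl.smooth_velocity, hsm, fun t ht x => ?_, hcl.divFree⟩
      have hg : gradient (fun x => p t x - p t e) x = gradient (p t) x := by
        simp only [gradient, fderiv_sub_const]
      rw [hg]
      exact hcl.momentum t ht x
    refine hcl'.onRegion.mono (prod_mono Ico_subset_Iio_self (subset_univ _)) ?_
    intro t x htx
    have hx : x ∈ ball (0 : EuclideanSpace ℝ (Fin 3)) 1 := (mem_prod.1 htx).2
    rw [show timeSection pvRegion x = Ico (-1 : ℝ) 0 from timeSection_prod _ hx]
    exact uniqueDiffOn_Ico (-1 : ℝ) 0 t (mem_prod.1 htx).1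
  · -- the bound on the annulus
    intro t ht x hx1 hx2
    have ht0 : t < 0 := ht.2
    have hx0 : x ≠ 0 := by
      intro h; rw [h, norm_zero] at hx1; norm_num at hx1
    have hid : p t x - p t e = pressurePotential (u t) x - pressurePotential (u t) e := by
      have h1 := pressure_sub_pressurePotential_const hcl hI ht0 x
      have h2 := pressure_sub_pressurePotential_const hcl hI ht0 e
      linarith
    show |p t x - p t e| ≤ 8 * D + 1
    rw [hid]
    have hQx := hD u p hcl hI t ht0 x hx0
    have hQe := hD u p hcl hI t ht0 e he0
    have hbx : D / ‖x‖ ^ 2 ≤ 4 * D := by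
      rw [div_le_iff₀ (by positivity)]
      have hsq : 1 ≤ 4 * ‖x‖ ^ 2 := by nlinarith [hx1, norm_nonneg x]
      calc D = D * 1 := (mul_one D).symm
        _ ≤ D * (4 * ‖x‖ ^ 2) := mul_le_mul_of_nonneg_left hsq hD0
        _ = 4 * D * ‖x‖ ^ 2 := by ring
    have hbe : D / ‖e‖ ^ 2 ≤ 4 * D := by
      rw [he, div_le_iff₀ (by positivity)]
      nlinarith [hD0]
    calc |pressurePotential (u t) x - pressurePotential (u t) e|
        ≤ |pressurePotential (u t) x| + |pressurePotential (u t) e| := abs_sub _ _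
      _ ≤ 4 * D + 4 * D := add_le_add (hQx.trans hbx) (hQe.trans hbe)
      _ ≤ 8 * D + 1 := by linarith

end Summit.NavierStokesRegularity.NavierStokesRegularity.Cruxes.TypeIQuantSubcubicExp.FlatWindow

end
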